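/-
Copyright (c) 2026 the pub-hodgecm-mathlib formalisation cell (harness21).  Prover seat hodgecm-mathlib-K2E1-p15 (g0), Track B ∕ K2-LIT «5Res (d)-assembly», h413 = `stmt-HodgeConjecture-24833`,
line `K2_E1_TraceFormulaBeta`, route of record `HCCMUnconditional`; dealer K2E1-plan (g7) deals (131)∕(150)(ii) «then the assembly» — the skeleton, hypothesis-first over ★ row 14
F2∕F2b, ★ row 15, my ★ (150)(i) pole-exclusion bounds, and the ARCH-UNITARITY letter `hmc` (★ F3∕F2b, K2E4-p23).
-/
import Summits.HodgeConjecture.HodgeConjecture.Theorems.K2E1ChiEisensteinPoleExclusionCMTwo     -- (this seat) (150)(i): `chiPoleExclusion_bounds_cm_two`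
import Summits.HodgeConjecture.HodgeConjecture.Theorems.K2E1BLRemovablePolesU                   -- ★ (L4) (K2E4-p10): `MeromorphicNFAt.analyticAt_of_eventually_norm_le`, `meromorphicOrderAt_nonneg_of_eventually_norm_le`
import Summits.HodgeConjecture.HodgeConjecture.Theorems.K2E1ArchTorusCoefficientExpansionU11    -- ★ F2b (K2E4-p23): `arch_unitarity_of_rightRegular_matrixCoeff` (letter `hmc` ⇒ `Im s = 0 ∨ Re s = ½`)
import HarnessLib

/-!
# K2·E1 — `K2E1ChiEisensteinNoComplexPoleCMTwo`: THE (d)-ASSEMBLY SKELETON — «OFF THE REAL AXIS THE CONTINUED `(χ, τ)` FAMILY HAS NO POLE IN `½ < Re z`; AND A RESIDUAL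
# VECTOR WITH A NON-TRIVIAL ARCHIMEDEAN TWIST `t_v ≠ 0` DOES NOT EXIST» — hypothesis-first over ★ (150)(i), ★ (L4) and ★ ARCH-UNITARITY

Track B ∕ K2-LIT, crux h413 = `stmt-HodgeConjecture-24833`; cell `hodgecm-mathlib`, squad K2, ENGINE E1, campaign «5Res», road of record «BL-2(χ,τ) ∘ MS-2(χ,τ) ∘ ARCH-UNITARITY
∘ R8₂» (TABLE 13th issue §F (d); census K2E4-p23 (g2)).  THEOREMS ONLY (no `def`, no `instance`, no notation, no named-fact hypothesis, no `sorry`); lane `--kind proof --supports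
stmt-HodgeConjecture-24833 --as helper` (count-neutral).  Closes no socket.

THE STATEMENT BEING ASSEMBLED ([MoeglinWaldspurger1995, IV.1.11, IV.3.12 (a), V.3.13]; [Bump1997, Thm. 2.6.3]).  For a cuspidal datum `(χ, τ)` on the Borel of `U(1,1)_{L∕L⁺}` and a section
`φ ∈ V(χ, τ, U)` the continued Eisenstein family `Ẽ(φ, z)` ∕ intertwining operator `M(z, χ)` can have poles in `½ < Re z` only ON THE REAL SEGMENT `(½, 1]` (Maass–Selberg), none at
all when `χ ≠ χʷ` (the two-term relation, ★ T1-χ of K2E4-p11), and a residual vector `Res_{z₀} Ẽ(φ)` with archimedean datum `s = z₀ + i t_v` forces `t_v = 0` (ARCH-UNITARITY: unitarity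
of the right regular representation makes the torus coefficient `Φ_{s,m}` real, whence `Im s·(2 Re s − 1) = 0`).  This file is the SKELETON in letters:
* §1 (pure plane topology) **`exists_eventually_le_of_boxBound`** — a box bound (a2) on a set `D₁` that is eventually a punctured neighbourhood of `z₁ ∈ D⁺` gives `∃ C, ∀ᶠ z in 𝓝[≠] z₁, b z ≤ C`.
* §2 (CM pair) **`chi_eventually_bracket_le_near_cm_two`** — ★ (150)(i) `chiPoleExclusion_bounds_cm_two` ∘ §1 with the co-discreteness of `U` (★ X1_χ) and of `P` (★ row 13 ∕ X2_χ): at EVERY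
  `z₁ ∈ D⁺ ∩ D_n` (pole or not) the bracket `b(z) = ‖M(z,χ)φ‖²`-letter is bounded on a punctured neighbourhood.
* §3 (removability, scalar) **`analyticAt_of_sq_le_bracket`**, **`meromorphicOrderAt_nonneg_of_sq_le_bracket`** — any scalar piece `q` (a matrix entry of `M(z, χ)` against an orthonormal
  basis, ★ X2_χ `qc j`) normal-form meromorphic at `z₁` and DOMINATED by the bracket (`‖q z‖² ≤ c₀·b z` nearby) is ANALYTIC at `z₁`: «NO POLE OFF THE REAL AXIS» (★ (L4) Riemann brick).
* §4 (arch) **`archTwist_eq_zero_of_rightRegular_matrixCoeff`** — the letter `hmc` for a residual vector of arch datum `s = ⟨z₀, t_v⟩` with `z₀ ≠ ½` forces `t_v = 0` (★ F2b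
  `arch_unitarity_of_rightRegular_matrixCoeff`).
The off-dual half («`χ ≠ χʷ` ⇒ no pole in `½ < Re` at all», from ★ `normSq_le_of_family_offDual_on'`) is ★ T1-χ `K2E1ChiScatteringBoundMaassSelbergU2` (K2E4-p11) and is not restated.

HONEST LABEL: HC_CM is proved only modulo the 7 printed citations (2 remaining named inputs: hLiu418 = `stmt-HodgeConjecture-24832`, h413 = `stmt-HodgeConjecture-24833`) until rung 0
closes; this file asserts no named fact, is conditional by construction on its binders (`Fam`, (E1), `h4`, the bracket letters, `hmc`), and closes no socket.

## References
* [MoeglinWaldspurger1995] C. Mœglin, J.-L. Waldspurger, *Spectral decomposition and Eisenstein series* (1995), IV.1.9, IV.1.11, IV.3.12 (a), V.3.13.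
* [Bump1997] D. Bump, *Automorphic Forms and Representations* (1997), §2.6 Thm. 2.6.3.
* [BernsteinLapid2019] J. Bernstein, E. Lapid, *On the meromorphic continuation of Eisenstein series*, J. AMS 37 (2024), Thm 2.3, §4.
-/

set_option autoImplicit false
set_option linter.dupNamespace false  -- the mandated namespace repeats the summit's segment (`HodgeConjecture.HodgeConjecture`)

noncomputable section

open MeasureTheory MeasureTheory.Measure Set NumberField IsDedekindDomain Filter Topology
open scoped NNReal ENNReal ComplexConjugate InnerProductSpace
open Literature.MeasureTheory.Group Literature.NumberTheory
open Literature.NumberTheory.Automorphic Literature.NumberTheory.Automorphic.UnitaryGroup AdelicGroupData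
open Summit.HodgeConjecture.HodgeConjecture.Cruxes.H413.K2E1BorelEisensteinU
open Summit.HodgeConjecture.HodgeConjecture.Cruxes.H413.K2E1ChiEisensteinPoleExclusionCMTwo (chiPoleExclusion_bounds_cm_two)
open Summit.HodgeConjecture.HodgeConjecture.Cruxes.H413.K2E1ArchTorusCoefficientU11Defs (archTorusCoeff)
open Summit.HodgeConjecture.HodgeConjecture.Cruxes.H413.K2E1ArchTorusCoefficientExpansionU11 (arch_unitarity_of_rightRegular_matrixCoeff)

namespace Summit.HodgeConjecture.HodgeConjecture.Cruxes.H413.K2E1ChiEisensteinNoComplexPoleCMTwo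

/-! ## §1 A box bound on an eventually-punctured-neighbourhood set gives a punctured-neighbourhood bound -/

/-- **FROM THE BOX BOUND (a2) TO A PUNCTURED-NEIGHBOURHOOD BOUND.**  If `b ≤ BOX(x₂, η)` holds at every `z ∈ D₁` for every box `x₁ ≤ Re z − ½ ≤ x₂`, `0 < η ≤ |Im z|` (the (a2) clause of
★ `poleControl_of_fourTerm`), and `D₁` contains a punctured neighbourhood of a point `z₁` with `½ < Re z₁`, `0 < Im z₁`, then `b` is bounded on a punctured neighbourhood of `z₁` (the
box `[d∕2, 3d∕2] × {|Im| ≥ Im z₁ ∕ 2}`, `d = Re z₁ − ½`, contains the disc of radius `min(d, Im z₁)∕2` about `z₁`). [cite: MoeglinWaldspurger1995, IV.3.12 (a)] -/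
theorem exists_eventually_le_of_boxBound {D₁ : Set ℂ} {b : ℂ → ℝ} {a T : ℝ}
    (hbox : ∀ z ∈ D₁, ∀ {x₁ x₂ η : ℝ}, 0 < x₁ → (z.re - 1 / 2) ∈ Set.Icc x₁ x₂ → 0 < η → η ≤ |z.im| →
      b z ≤ (x₂ * T ^ (2 * x₂) * Real.sqrt a / η + Real.sqrt (x₂ ^ 2 * T ^ (4 * x₂) * a / η ^ 2 + a * T ^ (4 * x₂))) ^ 2)
    {z₁ : ℂ} (hz₁ : 1 / 2 < z₁.re ∧ 0 < z₁.im) (hev : ∀ᶠ z in 𝓝[≠] z₁, z ∈ D₁) :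
    ∃ C : ℝ, ∀ᶠ z in 𝓝[≠] z₁, b z ≤ C := by
  obtain ⟨h1, h2⟩ := hz₁
  set d : ℝ := z₁.re - 1 / 2 with hd
  have hd0 : 0 < d := by rw [hd]; linarith
  set r : ℝ := min d z₁.im / 2 with hr
  have hr0 : 0 < r := by rw [hr]; positivity
  refine ⟨(3 * d / 2 * T ^ (2 * (3 * d / 2)) * Real.sqrt a / (z₁.im / 2) + Real.sqrt ((3 * d / 2) ^ 2 * T ^ (4 * (3 * d / 2)) * a / (z₁.im / 2) ^ 2 + a * T ^ (4 * (3 * d / 2)))) ^ 2, ?_⟩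
  have hball : ∀ᶠ z in 𝓝[≠] z₁, z ∈ Metric.ball z₁ r := mem_nhdsWithin_of_mem_nhds (Metric.ball_mem_nhds z₁ hr0)
  filter_upwards [hev, hball] with z hzD hzb
  have hz : ‖z - z₁‖ < r := by rwa [Metric.mem_ball, dist_eq_norm] at hzb
  have hre : |z.re - z₁.re| < r := lt_of_le_of_lt (by simpa only [Complex.sub_re] using Complex.abs_re_le_norm (z - z₁)) hz
  have him : |z.im - z₁.im| < r := lt_of_le_of_lt (by simpa only [Complex.sub_im] using Complex.abs_im_le_norm (z - z₁)) hz
  have hrd : r ≤ d / 2 := by rw [hr]; exact div_le_div_of_nonneg_right (min_le_left _ _) (by norm_num)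
  have hri : r ≤ z₁.im / 2 := by rw [hr]; exact div_le_div_of_nonneg_right (min_le_right _ _) (by norm_num)
  rw [abs_lt] at hre him
  refine hbox z hzD (x₁ := d / 2) (x₂ := 3 * d / 2) (η := z₁.im / 2) (by positivity) ⟨?_, ?_⟩ (by positivity) ?_
  · rw [hd] at hrd ⊢; linarith
  · rw [hd] at hrd ⊢; linarith
  · rw [le_abs]; left; linarith

/-! ## §2 The `(χ, τ)` bracket is bounded near every point of `D⁺ ∩ D_n` -/

section CM

variable (L : Type) [Field L] [NumberField L] [IsCMField L]
  [MeasurableSpace (quasiSplit (↥(maximalRealSubfield L)) L (IsCMField.complexConj L) 2).Adelic]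

/-- **THE `(χ, τ)` BRACKET `b(z)` IS BOUNDED ON A PUNCTURED NEIGHBOURHOOD OF EVERY `z₁ ∈ D⁺ ∩ D_n`** (pole or not): ★ (150)(i) `chiPoleExclusion_bounds_cm_two` (its letters VERBATIM)
∘ §1, with the co-discreteness of the holomorphy set `U` in the ball (★ X1_χ) and of the exceptional set `P` (★ row 13 `chiEisenstein_meromorphic_globalPoleSet_of_balls`, clause
`∀ z₀, ∀ᶠ s in 𝓝[≠] z₀, s ∉ P`).  This is the input of ★ (L4)'s Riemann brick (§3): «no pole of the continued `(χ,τ)` family in `½ < Re z`, `Im z ≠ 0`». [cite: MoeglinWaldspurger1995, IV.3.12 (a)]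
[cite: BernsteinLapid2019, Thm 2.3, §4] -/
theorem chi_eventually_bracket_le_near_cm_two
    (μ : Measure (quasiSplit (↥(maximalRealSubfield L)) L (IsCMField.complexConj L) 2).automorphicQuotient)
    (ν : Measure ↥(adelicUnipotent (↥(maximalRealSubfield L)) L (IsCMField.complexConj L) 2)) (𝓕 : Set ↥(adelicUnipotent (↥(maximalRealSubfield L)) L (IsCMField.complexConj L) 2))
    (n : ℕ) (hn : 2 ≤ n) {U : Set ℂ} (hUo : IsOpen U) (hUcod : ∀ z₀ ∈ Metric.ball (0 : ℂ) (n + 2), ∀ᶠ s in 𝓝[≠] z₀, s ∈ U)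
    {P : Set ℂ} (hPc : IsClosed P) (hPcount : P.Countable) (hPcod : ∀ z₀ : ℂ, ∀ᶠ s in 𝓝[≠] z₀, s ∉ P)
    {T₀ : ℝ≥0} (hT₀ : 1 ≤ T₀) {cμ K : ℝ} (hcμ : 0 < cμ) (hK : 0 < K) {a : ℝ} (ha : 0 < a) {b : ℂ → ℝ}
    (hb : ∀ z ∈ ({z : ℂ | 1 / 2 < z.re ∧ 0 < z.im} ∩ Metric.ball (0 : ℂ) (n + 2) ∩ U) \ P, 0 ≤ b z)
    {B₁ : ℂ} {B₂ B₃ : ℂ → ℂ} {B₄ : ℂ → ℂ → ℂ} (hB₁ : B₁ = ((a : ℝ) : ℂ))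
    (hB₂ : DifferentiableOn ℂ (fun w : ℂ => B₂ (conj w)) {w : ℂ | conj w ∈ ({z : ℂ | 1 / 2 < z.re ∧ 0 < z.im} ∩ Metric.ball (0 : ℂ) (n + 2) ∩ U) \ P})
    (hB₃ : DifferentiableOn ℂ B₃ (({z : ℂ | 1 / 2 < z.re ∧ 0 < z.im} ∩ Metric.ball (0 : ℂ) (n + 2) ∩ U) \ P))
    (hB₃₂ : ∀ z ∈ ({z : ℂ | 1 / 2 < z.re ∧ 0 < z.im} ∩ Metric.ball (0 : ℂ) (n + 2) ∩ U) \ P, B₃ z = conj (B₂ z))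
    (hB₄₁ : ∀ z' ∈ ({z : ℂ | 1 / 2 < z.re ∧ 0 < z.im} ∩ Metric.ball (0 : ℂ) (n + 2) ∩ U) \ P,
      DifferentiableOn ℂ (fun z : ℂ => B₄ z z') (({z : ℂ | 1 / 2 < z.re ∧ 0 < z.im} ∩ Metric.ball (0 : ℂ) (n + 2) ∩ U) \ P))
    (hB₄₂ : ∀ z ∈ ({z : ℂ | 1 / 2 < z.re ∧ 0 < z.im} ∩ Metric.ball (0 : ℂ) (n + 2) ∩ U) \ P,
      DifferentiableOn ℂ (fun w : ℂ => B₄ z (conj w)) {w : ℂ | conj w ∈ ({z : ℂ | 1 / 2 < z.re ∧ 0 < z.im} ∩ Metric.ball (0 : ℂ) (n + 2) ∩ U) \ P})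
    (hB₄d : ∀ z ∈ ({z : ℂ | 1 / 2 < z.re ∧ 0 < z.im} ∩ Metric.ball (0 : ℂ) (n + 2) ∩ U) \ P, B₄ z z = ((b z : ℝ) : ℂ))
    (hCS : ∀ z ∈ ({z : ℂ | 1 / 2 < z.re ∧ 0 < z.im} ∩ Metric.ball (0 : ℂ) (n + 2) ∩ U) \ P, ‖B₂ z‖ ^ 2 ≤ a * b z)
    (φ : (quasiSplit (↥(maximalRealSubfield L)) L (IsCMField.complexConj L) 2).Adelic → ℂ)
    (Ec : ℂ → (quasiSplit (↥(maximalRealSubfield L)) L (IsCMField.complexConj L) 2).Adelic → ℂ) (hE1 : ∀ z : ℂ, 1 < z.re → Ec z = eisensteinSeriesU (flatSectionU φ z))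
    (Fam : ℂ → Lp ℂ 2 μ) (hFd : DifferentiableOn ℂ Fam (({z : ℂ | 1 / 2 < z.re ∧ 0 < z.im} ∩ Metric.ball (0 : ℂ) (n + 2) ∩ U) \ P))
    (hFam : ∀ z ∈ ({z : ℂ | 1 / 2 < z.re ∧ 0 < z.im} ∩ Metric.ball (0 : ℂ) (n + 2) ∩ U) \ P,
      ((Fam z : Lp ℂ 2 μ) : (quasiSplit (↥(maximalRealSubfield L)) L (IsCMField.complexConj L) 2).automorphicQuotient → ℂ) =ᵐ[μ]
        (quasiSplit (↥(maximalRealSubfield L)) L (IsCMField.complexConj L) 2).quotFun (truncation ν 𝓕 T₀ (Ec z)))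
    (h4 : ∀ z z' : ℂ, 1 < z'.re → z'.re < z.re →
      ∫ x, (quasiSplit (↥(maximalRealSubfield L)) L (IsCMField.complexConj L) 2).quotFun (truncation ν 𝓕 T₀ (eisensteinSeriesU (flatSectionU φ z))) x * conj ((quasiSplit (↥(maximalRealSubfield L)) L (IsCMField.complexConj L) 2).quotFun (truncation ν 𝓕 T₀ (eisensteinSeriesU (flatSectionU φ z'))) x) ∂μ =
      ((cμ : ℝ) : ℂ) * (((K : ℝ) : ℂ) *
        ((((T₀ : ℝ) : ℂ) ^ (z + conj z' - 1) / (z + conj z' - 1)) * B₁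
          + (((T₀ : ℝ) : ℂ) ^ (z - conj z') / (z - conj z')) * B₂ z'
          - (((T₀ : ℝ) : ℂ) ^ (-(z - conj z')) / (z - conj z')) * B₃ z
          - (((T₀ : ℝ) : ℂ) ^ (-(z + conj z' - 1)) / (z + conj z' - 1)) * B₄ z z')))
    {z₁ : ℂ} (hz₁ : 1 / 2 < z₁.re ∧ 0 < z₁.im) (hz₁b : z₁ ∈ Metric.ball (0 : ℂ) (n + 2)) :
    ∃ C : ℝ, ∀ᶠ z in 𝓝[≠] z₁, b z ≤ C := by
  have hMS := chiPoleExclusion_bounds_cm_two L μ ν 𝓕 n hn hUo hUcod hPc hPcount hT₀ hcμ hK ha hb hB₁ hB₂ hB₃ hB₃₂ hB₄₁ hB₄₂ hB₄d hCS φ Ec hE1 Fam hFd hFam h4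
  have hQo : IsOpen ({z : ℂ | 1 / 2 < z.re ∧ 0 < z.im} ∩ Metric.ball (0 : ℂ) (n + 2)) :=
    ((isOpen_lt continuous_const Complex.continuous_re).inter (isOpen_lt continuous_const Complex.continuous_im)).inter Metric.isOpen_ball
  have hev : ∀ᶠ z in 𝓝[≠] z₁, z ∈ ({z : ℂ | 1 / 2 < z.re ∧ 0 < z.im} ∩ Metric.ball (0 : ℂ) (n + 2) ∩ U) \ P := by
    filter_upwards [mem_nhdsWithin_of_mem_nhds (hQo.mem_nhds ⟨hz₁, hz₁b⟩), hUcod z₁ hz₁b, hPcod z₁] with z hzC hzU hzP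
    exact ⟨⟨hzC, hzU⟩, hzP⟩
  exact exists_eventually_le_of_boxBound (fun z hz => (hMS z hz).2.1) hz₁ hev

end CM

/-! ## §3 Removability of bracket-dominated scalar pieces -/

/-- **A BRACKET-DOMINATED SCALAR PIECE HAS NO POLE**: `q` meromorphic IN NORMAL FORM at `z₁`, `‖q z‖² ≤ c₀·b z` on a punctured neighbourhood (a matrix entry `⟪e_j, M(z,χ)φ⟫` against the
bracket `b = κm‖M(z,χ)φ‖²`), and `b` bounded there (§2) ⟹ `q` ANALYTIC at `z₁` (★ (L4) `MeromorphicNFAt.analyticAt_of_eventually_norm_le`). [cite: MoeglinWaldspurger1995, IV.1.9, IV.3.12 (a)] -/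
theorem analyticAt_of_sq_le_bracket {q : ℂ → ℂ} {b : ℂ → ℝ} {z₁ : ℂ} (hq : MeromorphicNFAt q z₁) {c₀ : ℝ}
    (hdom : ∀ᶠ z in 𝓝[≠] z₁, ‖q z‖ ^ 2 ≤ c₀ * b z) (hbdd : ∃ C : ℝ, ∀ᶠ z in 𝓝[≠] z₁, b z ≤ C) (hc₀ : 0 ≤ c₀) : AnalyticAt ℂ q z₁ := by
  obtain ⟨C, hC⟩ := hbdd
  refine hq.analyticAt_of_eventually_norm_le ⟨Real.sqrt (c₀ * max C 0), ?_⟩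
  filter_upwards [hdom, hC] with z hz hzC
  refine Real.le_sqrt_of_sq_le (hz.trans (mul_le_mul_of_nonneg_left (hzC.trans (le_max_left _ _)) hc₀))

/-- **… AND NON-NEGATIVE ORDER** for a merely meromorphic `q` (same domination): `0 ≤ ord_{z₁} q` (★ (L4) `meromorphicOrderAt_nonneg_of_eventually_norm_le`). [cite: MoeglinWaldspurger1995, IV.1.9] -/
theorem meromorphicOrderAt_nonneg_of_sq_le_bracket {q : ℂ → ℂ} {b : ℂ → ℝ} {z₁ : ℂ} {c₀ : ℝ}
    (hdom : ∀ᶠ z in 𝓝[≠] z₁, ‖q z‖ ^ 2 ≤ c₀ * b z) (hbdd : ∃ C : ℝ, ∀ᶠ z in 𝓝[≠] z₁, b z ≤ C) (hc₀ : 0 ≤ c₀) : 0 ≤ meromorphicOrderAt q z₁ := by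
  obtain ⟨C, hC⟩ := hbdd
  refine K2E1BLRemovablePolesU.meromorphicOrderAt_nonneg_of_eventually_norm_le ⟨Real.sqrt (c₀ * max C 0), ?_⟩
  filter_upwards [hdom, hC] with z hz hzC
  refine Real.le_sqrt_of_sq_le (hz.trans (mul_le_mul_of_nonneg_left (hzC.trans (le_max_left _ _)) hc₀))

/-! ## §4 ARCH-UNITARITY: a residual vector forces a trivial archimedean twist -/

/-- **A RESIDUAL VECTOR WITH ARCH DATUM `s = z₀ + i t_v`, `z₀ ≠ ½`, HAS `t_v = 0`.**  For ANY ★ adelic group datum `𝒢` with an invariant measure `μ` on `G(F)∖G(𝔸)`, a torus family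
`t a` with `t a⁻¹ = (t a)⁻¹`, and `ψ ≠ 0` in `L²` whose diagonal matrix coefficient along `t` is the `U(1,1)` torus coefficient `Φ_{⟨z₀,t_v⟩, m}(a)·‖ψ‖²` (the letter `hmc`; E1: `ψ =
Res_{z₀} Ẽ(χ, φ_κ ⊗ φ^v)`, `t` the split torus at one real place, `m = p − q`): ★ `arch_unitarity_of_rightRegular_matrixCoeff` gives `t_v = 0 ∨ z₀ = ½`; off the unitary axis `t_v = 0` —
no residual pole in `(½, 1]` for a datum with a non-trivial unitary archimedean twist. [cite: Bump1997, §2.6 Thm. 2.6.3] [cite: MoeglinWaldspurger1995, IV.3, V.3.13] -/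
theorem archTwist_eq_zero_of_rightRegular_matrixCoeff {K : Type} [Field K] [NumberField K] (𝒢 : Literature.NumberTheory.Automorphic.AdelicGroupData.{0} K)
    (μ : Measure 𝒢.automorphicQuotient) [SMulInvariantMeasure 𝒢.Adelic 𝒢.automorphicQuotient μ]
    (t : ℝ → 𝒢.Adelic) (ht : ∀ a : ℝ, 0 < a → t a⁻¹ = (t a)⁻¹) {ψ : 𝒢.L2 μ} (hψ : ψ ≠ 0) {z₀ tv : ℝ} {m : ℤ} (hz₀ : z₀ ≠ 1 / 2)
    (hmc : ∀ a : ℝ, 0 < a → ⟪𝒢.rightRegular μ (t a) ψ, ψ⟫_ℂ = archTorusCoeff (⟨z₀, tv⟩ : ℂ) m a * ((‖ψ‖ ^ 2 : ℝ) : ℂ)) :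
    tv = 0 := by
  rcases arch_unitarity_of_rightRegular_matrixCoeff 𝒢 μ t ht hψ hmc with h | h
  · exact h
  · exact absurd h hz₀

end Summit.HodgeConjecture.HodgeConjecture.Cruxes.H413.K2E1ChiEisensteinNoComplexPoleCMTwo

end
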